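import Mathlib.LinearAlgebra.CrossProduct
import Mathlib.Analysis.SpecialFunctions.Complex.Arg
import Mathlib.Analysis.SpecialFunctions.Sqrt
import HarnessLib

/-!
# The placement charts of the LINK lineage in the kernel: every unit vector tight to two anchors
# is `A a + B b ± C (a × b)`, every unit vector at a given level from one anchor lies on the frame
# circle — the geometric core of the L-LINK premise (S_LINK) "chart exhaustiveness"

HONEST FRAMING. Part of the venture `Summits/Ventures/Crystal3D` (cell `pub-crystal3d`, phase 2;
seat p2, PROMOTION-AUDIT prep). Elementary linear algebra in `ℝ³` (vectors `Fin 3 → ℝ`, dot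
product `⬝ᵥ`, Mathlib's cross product `⨯₃`); nothing here asserts anything about GAP(1.26), no
census number moves. Purpose: the L-LINK lineage (idea-1's `link2` v2.4/v2.6/v3, replayed by
engine-1's `linkreplay` / `linkreplay3`; second lineage on the LINK-booked cells of CANDIDATE #6)
PLACES the hole contacts and shell directions of an item one at a time by the placement program
of `phase2/idea1/link/MATH.md` §1 — steps P0 / HA (hole partner at azimuth `φ`:
`x_v = (s cos φ, s sin φ, c)`), TA (tight to one placed `u`:
`x_v = ½ u + (√3/2)(cos α · e₁ + sin α · e₂)` with frame Z `e₁ = (e₃ − g u)/q`,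
`e₂ = (u_y, −u_x, 0)/q`, `g = u_z`, `q = √(1 − g²)`, or frame X with `g = u_x`,
`e₁ = (e_x − g u)/q`, `e₂ = (0, u_z, −u_y)/q`), HT / TT (two-fold: `x_v = A a + B b + C n`,
`n = a × b`, `C²·den = rad`) — and its ONE structural premise beyond `IsGapConfig` + the item is
**(S_LINK) "chart exhaustiveness"**: every configuration satisfying the rows is reached by the
program (L-LINK audit dossier `phase2/idea1/link/promo/L-LINK-AUDIT-DOSSIER-idea1-g15.md` §1 row
(S_LINK): "NOT a kernel row … read SOUND by red-2 / ref-2; the replayers do NOT certify it").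
THIS file proves the GEOMETRIC CORE of (S_LINK) — each chart, at a non-degenerate frame, covers
EVERY unit vector with the prescribed inner products:

* `smul_eq_smul_cross_of_perp`: a vector orthogonal to `u` and `w` is a multiple of `u × w`
  (`|u × w|² Z = (Z·(u × w)) (u × w)`, from the vector triple product — no basis argument);
* **`twoAnchor_chart`**: unit `a, b`, `g = a·b`, `g² < 1`, unit `X` with `X·a = κ₁`, `X·b = κ₂`
  ⇒ `X = A a + B b + C (a × b)`, `A = (κ₁ − gκ₂)/(1−g²)`, `B = (κ₂ − gκ₁)/(1−g²)`,
  `C²(1 − g²) = 1 − A² − B² − 2ABg`; instances **`link_TT_chart`** (`κ₁ = κ₂ = ½`: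
  `X = (u + w)/(2(1+h)) + C (u × w)`, `C²·2(1+h)²(1−h) = 1 + 2h` — MATH.md's `den`, `rad`
  verbatim) and **`link_HT_chart`** (`a = e₃`, `κ₁ = c`, `κ₂ = ½`: `e₃ × u = (−u_y, u_x, 0)`,
  `A = (c − g/2)/(1−g²)`, `B = (½ − gc)/(1−g²)`, `C²(1−g²) = 1 − A² − B² − 2ABg`);
* **`oneAnchor_chart`**: unit `u`, unit `e ⊥ u`, unit `X` with `X·u = κ`, `κ² < 1` ⇒
  `X = κ u + √(1−κ²)(cos α · e + sin α · (u × e))` for some `α`; `link_frame` (LINK's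
  `e₁ = (e₀ − g u)/q` is a unit vector `⊥ u` with `u × e₁ = (u × e₀)/q`); instances
  **`link_TA_frameZ_chart`**, **`link_TA_frameX_chart`** (`u × e₃ = (u_y, −u_x, 0)`,
  `u × e_x = (0, u_z, −u_y)` — LINK's `e₂` in both frames IS `u × e₁`) and **`link_HA_chart`**
  (`X = c e₃ + √(1−c²)(cos φ · e_x + sin φ · e_y)`).

So both signs of `C` (SIGN branching / the `'.'`-hull / P-mode slot of MATH.md §1) and the full
circle of `α`, `φ` cover every solution of a step's equations. What remains of (S_LINK) OUTSIDE
the kernel: the program bookkeeping (mode switches PENTER/PEXIT/CONTRACT keep supersets — each a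
one-line set inclusion in MATH.md §1), the gauge (P0: rotation about `e₃`; slot 1 restricted to
`[0, π]` by the reflection `y ↦ −y` — O(3)-invariance of the rows), and the degenerate frames
`q = 0` (`g² = 1`: the "entire-enclosure lemma" of README-LINKREPLAY, handled there by the
`±M⁺` hull) — this file's hypotheses `g² < 1`, `κ² < 1` are exactly the non-degenerate case.

References: idea-1, `phase2/idea1/link/MATH.md` §1 (LINK v2.4 placement map), MATH-v3-ADDENDUM §9;
engine-1, `README-LINKREPLAY.md` «(S_LINK)».
-/

noncomputable section

namespace Summit.Ventures.Crystal3D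

open Matrix

section Decomposition

/-- **A vector orthogonal to `u` and `w` is a multiple of `u × w`**:
`((u × w)·(u × w)) • Z = (Z·(u × w)) • (u × w)` (vector triple product; no basis argument).
[folklore] -/
theorem smul_eq_smul_cross_of_perp {u w Z : Fin 3 → ℝ} (hZu : Z ⬝ᵥ u = 0) (hZw : Z ⬝ᵥ w = 0) :
    ((u ⨯₃ w) ⬝ᵥ (u ⨯₃ w)) • Z = (Z ⬝ᵥ (u ⨯₃ w)) • (u ⨯₃ w) := by
  have h1 : Z ⨯₃ (u ⨯₃ w) = 0 := by
    rw [cross_cross_eq_smul_sub_smul', hZw, dotProduct_comm, hZu, zero_smul, zero_smul, sub_zero]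
  have h2 := cross_cross_eq_smul_sub_smul' (u ⨯₃ w) Z (u ⨯₃ w)
  rw [h1, map_zero] at h2
  exact (sub_eq_zero.1 h2.symm)

end Decomposition

section TwoAnchors

/-- **Two-anchor chart (the HT / TT steps of LINK are instances).** Unit `a, b` with
`g = a·b`, `g² < 1`; a unit `X` at levels `X·a = κ₁`, `X·b = κ₂`. Then with
`A = (κ₁ − gκ₂)/(1 − g²)`, `B = (κ₂ − gκ₁)/(1 − g²)`:
`X = A a + B b + C (a × b)` for some real `C` with `C² (1 − g²) = 1 − A² − B² − 2ABg`
(LINK `MATH.md` §1: "`x_v = A·a + B·b + C·n`, `C²·den = rad`"). Every such `X` is reached by the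
two signs of `C` — the two-fold chart is EXHAUSTIVE. [folklore] -/
theorem twoAnchor_chart {a b X : Fin 3 → ℝ} (ha : a ⬝ᵥ a = 1) (hb : b ⬝ᵥ b = 1)
    (hg : (a ⬝ᵥ b) ^ 2 < 1) {κ₁ κ₂ : ℝ} (h1 : X ⬝ᵥ a = κ₁) (h2 : X ⬝ᵥ b = κ₂)
    (hX : X ⬝ᵥ X = 1) :
    ∃ C : ℝ,
      X = ((κ₁ - (a ⬝ᵥ b) * κ₂) / (1 - (a ⬝ᵥ b) ^ 2)) • a +
          ((κ₂ - (a ⬝ᵥ b) * κ₁) / (1 - (a ⬝ᵥ b) ^ 2)) • b + C • (a ⨯₃ b) ∧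
      C ^ 2 * (1 - (a ⬝ᵥ b) ^ 2) =
        1 - ((κ₁ - (a ⬝ᵥ b) * κ₂) / (1 - (a ⬝ᵥ b) ^ 2)) ^ 2
          - ((κ₂ - (a ⬝ᵥ b) * κ₁) / (1 - (a ⬝ᵥ b) ^ 2)) ^ 2
          - 2 * ((κ₁ - (a ⬝ᵥ b) * κ₂) / (1 - (a ⬝ᵥ b) ^ 2)) *
              ((κ₂ - (a ⬝ᵥ b) * κ₁) / (1 - (a ⬝ᵥ b) ^ 2)) * (a ⬝ᵥ b) := by
  set g := a ⬝ᵥ b with hgdef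
  set A := (κ₁ - g * κ₂) / (1 - g ^ 2) with hA
  set B := (κ₂ - g * κ₁) / (1 - g ^ 2) with hB
  have hden : 1 - g ^ 2 ≠ 0 := by
    have : 0 < 1 - g ^ 2 := by linarith
    exact this.ne'
  have hAB1 : A + B * g = κ₁ := by rw [hA, hB]; field_simp; ring
  have hAB2 : A * g + B = κ₂ := by rw [hA, hB]; field_simp; ring
  have hba : b ⬝ᵥ a = g := by rw [dotProduct_comm]
  set Y := X - A • a - B • b with hY
  have hYa : Y ⬝ᵥ a = 0 := by
    simp only [hY, sub_dotProduct, smul_dotProduct, smul_eq_mul, h1, ha, hba]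
    linarith
  have hYb : Y ⬝ᵥ b = 0 := by
    simp only [hY, sub_dotProduct, smul_dotProduct, smul_eq_mul, h2, hb, ← hgdef]
    linarith
  have hnn : (a ⨯₃ b) ⬝ᵥ (a ⨯₃ b) = 1 - g ^ 2 := by
    rw [cross_dot_cross, ha, hb, hba, ← hgdef]; ring
  have hdec := smul_eq_smul_cross_of_perp hYa hYb
  rw [hnn] at hdec
  set C := (Y ⬝ᵥ (a ⨯₃ b)) / (1 - g ^ 2) with hC
  have hYC : Y = C • (a ⨯₃ b) := by
    have h := congrArg (fun v => (1 - g ^ 2)⁻¹ • v) hdec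
    simp only [smul_smul, inv_mul_cancel₀ hden, one_smul] at h
    rw [h, hC, div_eq_inv_mul]
  refine ⟨C, ?_, ?_⟩
  · rw [← hYC, hY]; abel
  · have hYY : Y ⬝ᵥ Y = C ^ 2 * (1 - g ^ 2) := by
      rw [hYC, smul_dotProduct, dotProduct_smul, smul_eq_mul, smul_eq_mul, hnn]; ring
    have ha1 : a ⬝ᵥ X = κ₁ := by rw [dotProduct_comm]; exact h1
    have hb2 : b ⬝ᵥ X = κ₂ := by rw [dotProduct_comm]; exact h2
    have hYY2 : Y ⬝ᵥ Y = 1 - A ^ 2 - B ^ 2 - 2 * A * B * g := by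
      simp only [hY, sub_dotProduct, dotProduct_sub, smul_dotProduct, dotProduct_smul, smul_eq_mul,
        hX, h1, h2, ha1, hb2, ha, hb, hba, ← hgdef]
      linear_combination (2 * A) * hAB1 + (2 * B) * hAB2
    linarith [hYY, hYY2]

/-- **LINK's TT step is exhaustive.** Unit `u, w` with `h = u·w`, `h² < 1`; a unit `X` tight to
both (`X·u = X·w = 1/2`). Then `X = A (u + w) + C (u × w)` with `A = 1/(2(1+h))` and
`C²·(2(1+h)²(1−h)) = 1 + 2h` (LINK `MATH.md` §1 TT: "`A = B = 1/(2(1+h))`, `den = 2(1+h)²(1−h)`,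
`rad = 1 + 2h`, `C²·den = rad`"). [folklore] -/
theorem link_TT_chart {u w X : Fin 3 → ℝ} (hu : u ⬝ᵥ u = 1) (hw : w ⬝ᵥ w = 1)
    (hh : (u ⬝ᵥ w) ^ 2 < 1) (h1 : X ⬝ᵥ u = 1 / 2) (h2 : X ⬝ᵥ w = 1 / 2) (hX : X ⬝ᵥ X = 1) :
    ∃ C : ℝ, X = (1 / (2 * (1 + u ⬝ᵥ w))) • (u + w) + C • (u ⨯₃ w) ∧
      C ^ 2 * (2 * (1 + u ⬝ᵥ w) ^ 2 * (1 - u ⬝ᵥ w)) = 1 + 2 * (u ⬝ᵥ w) := by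
  obtain ⟨C, hXeq, hC⟩ := twoAnchor_chart hu hw hh h1 h2 hX
  set g := u ⬝ᵥ w with hgdef
  have hg1 : 1 + g ≠ 0 := by
    intro h0
    have hg' : g = -1 := by linarith
    have : g ^ 2 = 1 := by rw [hg']; norm_num
    linarith
  have hg2 : 1 - g ≠ 0 := by
    intro h0
    have hg' : g = 1 := by linarith
    have : g ^ 2 = 1 := by rw [hg']; norm_num
    linarith
  have hden : 1 - g ^ 2 ≠ 0 := by
    have : 1 - g ^ 2 = (1 - g) * (1 + g) := by ring
    rw [this]; exact mul_ne_zero hg2 hg1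
  have h2g : 2 * (1 + g) ≠ 0 := mul_ne_zero two_ne_zero hg1
  have hA : (1 / 2 - g * (1 / 2)) / (1 - g ^ 2) = 1 / (2 * (1 + g)) := by
    rw [div_eq_div_iff hden h2g]; ring
  rw [hA] at hXeq hC
  refine ⟨C, ?_, ?_⟩
  · rw [hXeq, smul_add]
  · have : C ^ 2 * (2 * (1 + g) ^ 2 * (1 - g)) = (C ^ 2 * (1 - g ^ 2)) * (2 * (1 + g)) := by ring
    rw [this, hC]
    field_simp
    ring

/-- **LINK's HT step is exhaustive.** `u` a unit shell direction with `g = u_z`, `g² < 1`; a unit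
`X` with `X_z = c` (hole contact at level `c` with the hole direction `e₃`) and `X·u = 1/2`.
Then `X = A e₃ + B u + C (e₃ × u)`, `e₃ × u = (−u_y, u_x, 0)`, with `A = (c − g/2)/(1 − g²)`,
`B = (1/2 − gc)/(1 − g²)` and `C² (1 − g²) = 1 − A² − B² − 2ABg` (LINK `MATH.md` §1 HT).
[folklore] -/
theorem link_HT_chart {u X : Fin 3 → ℝ} {c : ℝ} (hu : u ⬝ᵥ u = 1) (hg : (u 2) ^ 2 < 1)
    (hXz : X 2 = c) (hXu : X ⬝ᵥ u = 1 / 2) (hX : X ⬝ᵥ X = 1) :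
    ∃ C : ℝ, X = ((c - u 2 * (1 / 2)) / (1 - (u 2) ^ 2)) • ![0, 0, 1] +
        ((1 / 2 - u 2 * c) / (1 - (u 2) ^ 2)) • u + C • ![-(u 1), u 0, 0] ∧
      C ^ 2 * (1 - (u 2) ^ 2) = 1 - ((c - u 2 * (1 / 2)) / (1 - (u 2) ^ 2)) ^ 2
        - ((1 / 2 - u 2 * c) / (1 - (u 2) ^ 2)) ^ 2
        - 2 * ((c - u 2 * (1 / 2)) / (1 - (u 2) ^ 2)) * ((1 / 2 - u 2 * c) / (1 - (u 2) ^ 2))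
          * u 2 := by
  have he : (![0, 0, 1] : Fin 3 → ℝ) ⬝ᵥ ![0, 0, 1] = 1 := by
    simp [dotProduct, Fin.sum_univ_three]
  have hg' : (![0, 0, 1] : Fin 3 → ℝ) ⬝ᵥ u = u 2 := by
    simp [dotProduct, Fin.sum_univ_three]
  have h1 : X ⬝ᵥ ![0, 0, 1] = c := by
    simp [dotProduct, Fin.sum_univ_three, hXz]
  have hn : (![0, 0, 1] : Fin 3 → ℝ) ⨯₃ u = ![-(u 1), u 0, 0] := by
    rw [cross_apply]; simp
  have hg2 : ((![0, 0, 1] : Fin 3 → ℝ) ⬝ᵥ u) ^ 2 < 1 := by rw [hg']; exact hg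
  obtain ⟨C, hXeq, hC⟩ := twoAnchor_chart he hu hg2 h1 hXu hX
  rw [hg', hn] at hXeq
  rw [hg'] at hC
  exact ⟨C, hXeq, hC⟩

end TwoAnchors

section OneAnchor

/-- **One-anchor chart (the HA / TA steps of LINK are instances).** Unit `u`, a unit `e ⊥ u`
(first frame vector; the second is `u × e`); a unit `X` at level `X·u = κ`, `κ² < 1`. Then
`X = κ u + √(1 − κ²) (cos α · e + sin α · (u × e))` for some real `α` — the circle chart is
EXHAUSTIVE. [folklore] -/
theorem oneAnchor_chart {u e X : Fin 3 → ℝ} (hu : u ⬝ᵥ u = 1) (he : e ⬝ᵥ e = 1)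
    (heu : e ⬝ᵥ u = 0) {κ : ℝ} (hκ : κ ^ 2 < 1) (hX : X ⬝ᵥ X = 1) (hXu : X ⬝ᵥ u = κ) :
    ∃ α : ℝ, X = κ • u + Real.sqrt (1 - κ ^ 2) • (Real.cos α • e + Real.sin α • (u ⨯₃ e)) := by
  set n := u ⨯₃ e with hn
  have hue : u ⬝ᵥ e = 0 := by rw [dotProduct_comm]; exact heu
  have hnn : n ⬝ᵥ n = 1 := by rw [hn, cross_dot_cross, hu, he, hue, heu]; ring
  have hun : u ⬝ᵥ n = 0 := dot_self_cross u e
  have hen : e ⬝ᵥ n = 0 := dot_cross_self u e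
  have hnu : n ⬝ᵥ u = 0 := by rw [dotProduct_comm]; exact hun
  have hne : n ⬝ᵥ e = 0 := by rw [dotProduct_comm]; exact hen
  set p := X ⬝ᵥ e with hp
  set q := X ⬝ᵥ n with hq
  -- `X = κ u + p e + q n`
  set Z := X - κ • u - p • e - q • n with hZ
  have hZu : Z ⬝ᵥ u = 0 := by
    simp only [hZ, sub_dotProduct, smul_dotProduct, smul_eq_mul, hXu, hu, heu, hnu]; ring
  have hZe : Z ⬝ᵥ e = 0 := by
    simp only [hZ, sub_dotProduct, smul_dotProduct, smul_eq_mul, hue, he, hne, ← hp]; ring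
  have hZn : Z ⬝ᵥ n = 0 := by
    simp only [hZ, sub_dotProduct, smul_dotProduct, smul_eq_mul, hun, hen, hnn, ← hq]; ring
  have hdec := smul_eq_smul_cross_of_perp hZu hZe
  rw [← hn, hnn, one_smul, hZn, zero_smul] at hdec
  have hXeq : X = κ • u + p • e + q • n := by
    have : X - κ • u - p • e - q • n = 0 := hdec
    rw [sub_eq_zero] at this
    rw [← sub_eq_zero]
    have h' : X - κ • u - p • e = q • n := this
    rw [← h']; abel
  -- `p² + q² = 1 − κ²`
  have hpq : p ^ 2 + q ^ 2 = 1 - κ ^ 2 := by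
    have hXX := hX
    rw [hXeq] at hXX
    simp only [add_dotProduct, dotProduct_add, smul_dotProduct, dotProduct_smul, smul_eq_mul, hu, he,
      hnn, hue, heu, hun, hnu, hen, hne] at hXX
    nlinarith [hXX]
  -- the angle
  set s := Real.sqrt (1 - κ ^ 2) with hs
  have hs0 : 0 < s := Real.sqrt_pos.2 (by linarith)
  have hs2 : s ^ 2 = 1 - κ ^ 2 := Real.sq_sqrt (by linarith)
  set z : ℂ := (p : ℂ) + (q : ℂ) * Complex.I with hz
  have hnorm : ‖z‖ = s := by
    rw [hz, Complex.norm_add_mul_I, hs, hpq]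
  have hz0 : z ≠ 0 := by
    intro h0; rw [h0, norm_zero] at hnorm; linarith
  refine ⟨Complex.arg z, ?_⟩
  have hcos : Real.cos (Complex.arg z) = p / s := by
    rw [Complex.cos_arg hz0, hnorm, hz]; simp
  have hsin : Real.sin (Complex.arg z) = q / s := by
    rw [Complex.sin_arg, hnorm, hz]; simp
  rw [hcos, hsin, smul_add, smul_smul, smul_smul, mul_div_cancel₀ _ hs0.ne', mul_div_cancel₀ _ hs0.ne',
    ← add_assoc]
  exact hXeq

/-- `√(1 − (1/2)²) = √3/2`. [folklore] -/
theorem sqrt_one_sub_half_sq' : Real.sqrt (1 - (1 / 2 : ℝ) ^ 2) = Real.sqrt 3 / 2 := by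
  rw [show (1 : ℝ) - (1 / 2) ^ 2 = 3 / 4 by norm_num, show (3 : ℝ) / 4 = 3 / 2 ^ 2 by norm_num,
    Real.sqrt_div' _ (by norm_num : (0 : ℝ) ≤ 2 ^ 2), Real.sqrt_sq (by norm_num : (0 : ℝ) ≤ 2)]

/-- **LINK's frame lemma.** For a unit `u` and a unit coordinate vector `e₀` with `g = e₀·u`,
`g² < 1`, the vector `e₁ = (e₀ − g u)/√(1 − g²)` is a unit vector orthogonal to `u`, and
`u × e₁ = (u × e₀)/√(1 − g²)`. [folklore] -/
theorem link_frame {u e₀ : Fin 3 → ℝ} (hu : u ⬝ᵥ u = 1) (he₀ : e₀ ⬝ᵥ e₀ = 1)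
    (hg : (e₀ ⬝ᵥ u) ^ 2 < 1) :
    ((Real.sqrt (1 - (e₀ ⬝ᵥ u) ^ 2))⁻¹ • (e₀ - (e₀ ⬝ᵥ u) • u)) ⬝ᵥ
        ((Real.sqrt (1 - (e₀ ⬝ᵥ u) ^ 2))⁻¹ • (e₀ - (e₀ ⬝ᵥ u) • u)) = 1 ∧
      ((Real.sqrt (1 - (e₀ ⬝ᵥ u) ^ 2))⁻¹ • (e₀ - (e₀ ⬝ᵥ u) • u)) ⬝ᵥ u = 0 ∧
      u ⨯₃ ((Real.sqrt (1 - (e₀ ⬝ᵥ u) ^ 2))⁻¹ • (e₀ - (e₀ ⬝ᵥ u) • u)) =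
        (Real.sqrt (1 - (e₀ ⬝ᵥ u) ^ 2))⁻¹ • (u ⨯₃ e₀) := by
  set g := e₀ ⬝ᵥ u with hgdef
  set q := Real.sqrt (1 - g ^ 2) with hq
  have hq2 : q ^ 2 = 1 - g ^ 2 := Real.sq_sqrt (by linarith)
  have hq0 : q ≠ 0 := (Real.sqrt_pos.2 (by linarith)).ne'
  have hue₀ : u ⬝ᵥ e₀ = g := by rw [dotProduct_comm]
  refine ⟨?_, ?_, ?_⟩
  · simp only [smul_dotProduct, dotProduct_smul, sub_dotProduct, dotProduct_sub, smul_eq_mul, he₀,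
      hu, hue₀, ← hgdef]
    field_simp
    nlinarith [hq2]
  · simp only [smul_dotProduct, sub_dotProduct, smul_eq_mul, hu, ← hgdef]; ring
  · rw [map_smul, map_sub, map_smul, cross_self, smul_zero, sub_zero]

/-- **LINK's TA step (frame Z) is exhaustive.** `u` a placed unit shell direction with
`g = u_z`, `g² < 1` (frame Z is used while `u_z² ≤ 0.85`), `q = √(1 − g²)`,
`e₁ = (e₃ − g u)/q`, `e₂ = (u_y, −u_x, 0)/q`; a unit `X` tight to `u` (`X·u = 1/2`). Then
`X = ½ u + (√3/2)(cos α · e₁ + sin α · e₂)` for some `α` (LINK `MATH.md` §1 TA, frame Z). -/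
theorem link_TA_frameZ_chart {u X : Fin 3 → ℝ} (hu : u ⬝ᵥ u = 1) (hg : (u 2) ^ 2 < 1)
    (hXu : X ⬝ᵥ u = 1 / 2) (hX : X ⬝ᵥ X = 1) :
    ∃ α : ℝ, X = (1 / 2 : ℝ) • u + (Real.sqrt 3 / 2) •
      (Real.cos α • ((Real.sqrt (1 - (u 2) ^ 2))⁻¹ • (![0, 0, 1] - (u 2) • u)) +
        Real.sin α • ((Real.sqrt (1 - (u 2) ^ 2))⁻¹ • ![u 1, -(u 0), 0])) := by
  have he₀ : (![0, 0, 1] : Fin 3 → ℝ) ⬝ᵥ ![0, 0, 1] = 1 := by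
    simp [dotProduct, Fin.sum_univ_three]
  have hg' : (![0, 0, 1] : Fin 3 → ℝ) ⬝ᵥ u = u 2 := by
    simp [dotProduct, Fin.sum_univ_three]
  have hcross : u ⨯₃ (![0, 0, 1] : Fin 3 → ℝ) = ![u 1, -(u 0), 0] := by
    rw [cross_apply]; simp
  have hg2 : ((![0, 0, 1] : Fin 3 → ℝ) ⬝ᵥ u) ^ 2 < 1 := by rw [hg']; exact hg
  obtain ⟨h1, h2, h3⟩ := link_frame hu he₀ hg2
  rw [hg'] at h1 h2 h3
  obtain ⟨α, hα⟩ := oneAnchor_chart hu h1 h2 (by norm_num : (1 / 2 : ℝ) ^ 2 < 1) hX hXu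
  refine ⟨α, ?_⟩
  rw [h3, hcross, sqrt_one_sub_half_sq'] at hα
  exact hα

/-- **LINK's TA step (frame X) is exhaustive.** The same with `g = u_x`,
`e₁ = (e_x − g u)/q`, `e₂ = (0, u_z, −u_y)/q` (frame X, used when `u_z² > 0.85`). -/
theorem link_TA_frameX_chart {u X : Fin 3 → ℝ} (hu : u ⬝ᵥ u = 1) (hg : (u 0) ^ 2 < 1)
    (hXu : X ⬝ᵥ u = 1 / 2) (hX : X ⬝ᵥ X = 1) :
    ∃ α : ℝ, X = (1 / 2 : ℝ) • u + (Real.sqrt 3 / 2) •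
      (Real.cos α • ((Real.sqrt (1 - (u 0) ^ 2))⁻¹ • (![1, 0, 0] - (u 0) • u)) +
        Real.sin α • ((Real.sqrt (1 - (u 0) ^ 2))⁻¹ • ![0, u 2, -(u 1)])) := by
  have he₀ : (![1, 0, 0] : Fin 3 → ℝ) ⬝ᵥ ![1, 0, 0] = 1 := by
    simp [dotProduct, Fin.sum_univ_three]
  have hg' : (![1, 0, 0] : Fin 3 → ℝ) ⬝ᵥ u = u 0 := by
    simp [dotProduct, Fin.sum_univ_three]
  have hcross : u ⨯₃ (![1, 0, 0] : Fin 3 → ℝ) = ![0, u 2, -(u 1)] := by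
    rw [cross_apply]; simp
  have hg2 : ((![1, 0, 0] : Fin 3 → ℝ) ⬝ᵥ u) ^ 2 < 1 := by rw [hg']; exact hg
  obtain ⟨h1, h2, h3⟩ := link_frame hu he₀ hg2
  rw [hg'] at h1 h2 h3
  obtain ⟨α, hα⟩ := oneAnchor_chart hu h1 h2 (by norm_num : (1 / 2 : ℝ) ^ 2 < 1) hX hXu
  refine ⟨α, ?_⟩
  rw [h3, hcross, sqrt_one_sub_half_sq'] at hα
  exact hα

/-- **LINK's HA step is exhaustive.** A unit `X` at level `X_z = c` from the hole direction
`e₃` (`c² < 1`) is `(s cos φ, s sin φ, c)` with `s = √(1 − c²)`: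
`X = c e₃ + s (cos φ · e_x + sin φ · e_y)` (LINK `MATH.md` §1 HA / P0). [folklore] -/
theorem link_HA_chart {X : Fin 3 → ℝ} {c : ℝ} (hc : c ^ 2 < 1) (hXz : X 2 = c)
    (hX : X ⬝ᵥ X = 1) :
    ∃ φ : ℝ, X = c • ![0, 0, 1] + Real.sqrt (1 - c ^ 2) •
      (Real.cos φ • ![1, 0, 0] + Real.sin φ • ![0, 1, 0]) := by
  have hu : (![0, 0, 1] : Fin 3 → ℝ) ⬝ᵥ ![0, 0, 1] = 1 := by
    simp [dotProduct, Fin.sum_univ_three]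
  have he : (![1, 0, 0] : Fin 3 → ℝ) ⬝ᵥ ![1, 0, 0] = 1 := by
    simp [dotProduct, Fin.sum_univ_three]
  have heu : (![1, 0, 0] : Fin 3 → ℝ) ⬝ᵥ ![0, 0, 1] = 0 := by
    simp [dotProduct, Fin.sum_univ_three]
  have hXu : X ⬝ᵥ ![0, 0, 1] = c := by
    simp [dotProduct, Fin.sum_univ_three, hXz]
  have hcross : (![0, 0, 1] : Fin 3 → ℝ) ⨯₃ (![1, 0, 0] : Fin 3 → ℝ) = ![0, 1, 0] := by
    rw [cross_apply]; simp
  obtain ⟨φ, hφ⟩ := oneAnchor_chart hu he heu hc hX hXu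
  rw [hcross] at hφ
  exact ⟨φ, hφ⟩

end OneAnchor

end Summit.Ventures.Crystal3D
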